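import Summits.CriticalPhenomena.CardyFormulaZ2.Theorems.CardyTensorRGPolyominoGaussianLawUniversalLaw

/-!
# The route closes from the SHAPE-FREE dyadic polyomino law
# (crux `PolyominoGaussianLaw`, stmt-CriticalPhenomena-14337, route `CardyTensorRG`, line `registered`)

The route's deciding theorem is `closes : PolyominoGaussianLaw → PolyominoToJordan → CardyRigidity →
CardyFormulaZ2`, and `PolyominoToJordan` (stmt-14338) is proved. `…UniversalLaw` showed that under
`CardyRigidity` the crux `PolyominoGaussianLaw` is equivalent to the shape-free universal law along dyadic
orbits. This file records the resulting VERIFIED deciding theorem for the recommended restatement of the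
crux (registered helper stub `stub_closesOfShapeFreeDyadicLaw`):

  (∃ F continuous on (0,1), every dyadic orbit of every polyomino representation with lattice marks has
   bond-ℤ² crossing limit F(cross-ratio))  →  CardyRigidity  →  CardyFormulaZ2,

with `PolyominoToJordan` discharged by its landed proof. So if the planner restates stmt-14337 as the
shape-free dyadic law (strictly weaker than the current crux, and exactly what the tensor-RG chain
13817 + 7100 + 14645 is meant to output: existence + continuous cross-ratio dependence), the route's glue
is already a theorem.
-/

open Filter Topology Set

namespace Summit.CriticalPhenomena.CardyFormulaZ2.Cruxes.PolyominoGaussianLaw.Birth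

/-- **Deciding theorem for the shape-free restatement of the crux** (registered helper stub): the
shape-free universal dyadic polyomino law and Cardy rigidity imply Cardy's formula on bond-`ℤ²`
(`PolyominoToJordan` being proved). [folklore] -/
theorem stub_closesOfShapeFreeDyadicLaw :
    (∃ F : ℝ → ℝ, ContinuousOn F (Set.Ioo 0 1) ∧
        ∀ R : Literature.Probability.RandomPlanarGeometry.ConformalRectangle, ∀ δ₀ : ℝ, 0 < δ₀ →
        (∃ s : Finset (ℤ × ℤ), R.carrier = interior (⋃ p ∈ s, {z : ℂ | δ₀ * (p.1 : ℝ) ≤ z.re ∧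
          z.re ≤ δ₀ * ((p.1 : ℝ) + 1) ∧ δ₀ * (p.2 : ℝ) ≤ z.im ∧ z.im ≤ δ₀ * ((p.2 : ℝ) + 1)})) →
        (∀ i, ∃ m n : ℤ, R.pt i = (δ₀ : ℂ) * ((m : ℂ) + (n : ℂ) * Complex.I)) →
        ∀ (φ : Literature.Probability.RandomPlanarGeometry.ConformalEquiv UpperHalfPlane.upperHalfPlaneSet R.carrier)
          (x : Fin 4 → ℝ), R.IsUniformizing φ x →
        Filter.Tendsto
          (fun k : ℕ => Literature.Probability.Percolation.bondDomainCrossingProb R (δ₀ / 2 ^ k))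
          Filter.atTop (nhds (F (Literature.Probability.RandomPlanarGeometry.crossRatio x)))) →
    Summit.CriticalPhenomena.CardyFormulaZ2.Theses.CardyTensorRG.CardyRigidity →
    _root_.CardyFormulaZ2 := by
  intro hD hRig
  exact Summit.CriticalPhenomena.CardyFormulaZ2.Theses.CardyTensorRG.closes
    ((stub_dyadicUniversalLawIff hRig).2 hD)
    Summit.CriticalPhenomena.CardyFormulaZ2.Cruxes.PolyominoToJordan.Birth.PolyominoToJordan_proof hRig

/-- The same with the all-mesh shape-free law (`δ → 0⁺` for every polyomino conformal rectangle). [folklore] -/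
theorem closesOfShapeFreeLaw
    (hU : ∃ F : ℝ → ℝ, ContinuousOn F (Set.Ioo 0 1) ∧
      ∀ R : Literature.Probability.RandomPlanarGeometry.ConformalRectangle,
      (∃ δ₀ : ℝ, 0 < δ₀ ∧ (∃ s : Finset (ℤ × ℤ), R.carrier = interior (⋃ p ∈ s, {z : ℂ |
        δ₀ * (p.1 : ℝ) ≤ z.re ∧ z.re ≤ δ₀ * ((p.1 : ℝ) + 1) ∧ δ₀ * (p.2 : ℝ) ≤ z.im ∧
        z.im ≤ δ₀ * ((p.2 : ℝ) + 1)})) ∧ ∀ i, ∃ m n : ℤ, R.pt i = (δ₀ : ℂ) * ((m : ℂ) + (n : ℂ) * Complex.I)) →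
      R.HasCrossingLimit (Literature.Probability.Percolation.bondDomainCrossingProb R) F)
    (hRig : Summit.CriticalPhenomena.CardyFormulaZ2.Theses.CardyTensorRG.CardyRigidity) :
    _root_.CardyFormulaZ2 :=
  Summit.CriticalPhenomena.CardyFormulaZ2.Theses.CardyTensorRG.closes
    ((stub_universalLawIff hRig).2 hU)
    Summit.CriticalPhenomena.CardyFormulaZ2.Cruxes.PolyominoToJordan.Birth.PolyominoToJordan_proof hRig

end Summit.CriticalPhenomena.CardyFormulaZ2.Cruxes.PolyominoGaussianLaw.Birth
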